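import Mathlib

/-!
# Pintz 2006, Lemma 4′: a lower bound for the support of a non-negative INTEGER sequence from its
first two moments

Topic `Literature/NumberTheory/Sieve` (Romanov's theorem and its constant). Everything here is PROVED;
there are no named facts and no definitions.

J. Pintz, *A note on Romanov's constant*, Acta Math. Hungar. **112** (2006) 1–14, Lemma 4′, as restated
verbatim in D. R. Johnston, T. Trudgian, *An update on the Linnik–Goldbach and Romanov problems*,
arXiv:2605.17825v2 (2026), Lemma `pintzdenlem` (§4.2 "An observation of Pintz"):

> Suppose that `b(n) ∈ ℕ ∪ {0}` for each `n ≤ N`. Assume that `∑_{n ≤ N} b(n) = M` and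
> `∑_{n ≤ N} b(n)² ≤ D M`. Then `#{n ≤ N : b(n) > 0} ≥ (⌈D⌉ + ⌊D⌋ − D)/(⌈D⌉ ⌊D⌋) · M`.

This refines the Cauchy–Schwarz bound `#{b > 0} ≥ M / D` (which is what one gets for REAL `b ≥ 0`) by
using that `b` takes integer values; it is the device by which Pintz (2006) and Johnston–Trudgian (2026,
§4.2, `d ≥ 0.10695`) convert a mean-square bound for `r(n) = #{(p, k) : p + 2^k = n}` into a lower bound
for Romanov's constant. (The primary source is not held by the library at the time of writing — acquisition
request doi:10.1007/s10474-006-0060-6; the statement is taken from the verbatim restatement in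
Johnston–Trudgian, who cite it as `[Pintz 2006, Lemma 4′]`.)

## What is proved

* `Pintz2006.pointwise` — the one-line heart of the matter: for naturals `b`, `k`,
  `(2k + 1) b ≤ b² + k(k + 1)·[b > 0]`, i.e. `(b − k)(b − k − 1) ≥ 0` for an integer `b`.
* `Pintz2006.lemma4'_general` — for `b : ι → ℕ` on a finite index set `s`, ANY `k : ℕ` and any real `D`
  with `∑ b² ≤ D ∑ b`: `(2k + 1 − D) · ∑ b ≤ k(k + 1) · #{i ∈ s : b i > 0}` (summing `pointwise`);
  `Pintz2006.lemma4'_div` — the same divided by `k(k + 1)` for `k ≥ 1`.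
* `Pintz2006.lemma4'` — the printed statement (with `⌈D⌉₊`, `⌊D⌋₊`, for `D ≥ 1`): it is the case
  `k = ⌊D⌋` of the general form (for `D ∉ ℤ`, `⌈D⌉ = ⌊D⌋ + 1` and the two coefficients agree literally;
  for `D ∈ ℤ` both equal `1/D`).  The hypothesis `D ≥ 1` only excludes the degenerate range where the
  printed coefficient has a zero denominator (`⌊D⌋ = 0`); note `∑ b² ≥ ∑ b` forces `D ≥ 1` anyway unless
  `∑ b = 0`.

Design: the index set is an arbitrary `Finset ι` rather than `{1, …, N}`, and `M` is not named separately
(`M = ∑ b`); both are harmless generalisations of the printed statement. No `ℕ`-subtraction occurs: all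
arithmetic is in `ℝ`.

## References

* J. Pintz, *A note on Romanov's constant*, Acta Math. Hungar. 112 (2006), no. 1-2, 1–14, Lemma 4′. [Pintz2006]
* D. R. Johnston, T. Trudgian, *An update on the Linnik–Goldbach and Romanov problems*, arXiv:2605.17825 (2026),
  §4.2, Lemma `pintzdenlem` (restatement) and the application `d ≥ 0.10695`. [JohnstonTrudgian2026]
-/

open Finset

namespace Literature.NumberTheory.Sieve.Pintz2006

/-- Pointwise integrality inequality behind Pintz's Lemma 4′: for natural numbers `b`, `k`,
`(2k + 1)·b ≤ b² + k(k + 1)·[b > 0]` (in `ℝ`); equivalently `(b − k)(b − k − 1) ≥ 0`, which holds because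
`b − k` is an integer. [cite: Pintz2006, Lemma 4′ (proof)] -/
theorem pointwise (b k : ℕ) :
    (2 * k + 1 : ℝ) * b ≤ (b : ℝ) ^ 2 + (k * (k + 1) : ℝ) * (if 0 < b then 1 else 0) := by
  split_ifs with hb
  · rcases Nat.lt_or_ge b (k + 1) with h | h
    · have h' : (b : ℝ) ≤ k := by exact_mod_cast Nat.lt_succ_iff.mp h
      nlinarith [mul_nonneg (sub_nonneg.mpr h') (by linarith : (0 : ℝ) ≤ (k : ℝ) + 1 - b)]
    · have h' : (k : ℝ) + 1 ≤ b := by exact_mod_cast h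
      nlinarith [mul_nonneg (by linarith : (0 : ℝ) ≤ (b : ℝ) - k) (sub_nonneg.mpr h')]
  · have hb0 : b = 0 := by omega
    subst hb0
    simp

/-- **Pintz's Lemma 4′, general form** (every `k`). For `b : ι → ℕ` on a finite set `s` with
`∑ b² ≤ D · ∑ b` and any `k : ℕ`: `(2k + 1 − D) · ∑_{i ∈ s} b i ≤ k(k + 1) · #{i ∈ s : b i > 0}`.
The printed lemma is the case `k = ⌊D⌋` (see `lemma4'`). [cite: Pintz2006, Lemma 4′] -/
theorem lemma4'_general {ι : Type*} (s : Finset ι) (b : ι → ℕ) (D : ℝ) (k : ℕ)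
    (hD : (∑ i ∈ s, (b i : ℝ) ^ 2) ≤ D * ∑ i ∈ s, (b i : ℝ)) :
    ((2 * k + 1 : ℝ) - D) * (∑ i ∈ s, (b i : ℝ))
      ≤ (k * (k + 1) : ℝ) * ((s.filter (fun i => 0 < b i)).card : ℝ) := by
  have hpt : ∀ i ∈ s,
      (2 * k + 1 : ℝ) * b i ≤ (b i : ℝ) ^ 2 + (k * (k + 1) : ℝ) * (if 0 < b i then 1 else 0) :=
    fun i _ => pointwise (b i) k
  have hsum := Finset.sum_le_sum hpt
  rw [Finset.sum_add_distrib, ← Finset.mul_sum, ← Finset.mul_sum] at hsum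
  have hcard : (∑ i ∈ s, (if 0 < b i then (1 : ℝ) else 0))
      = ((s.filter (fun i => 0 < b i)).card : ℝ) := by
    rw [Finset.sum_boole]
  rw [hcard] at hsum
  have : ((2 * k + 1 : ℝ) - D) * (∑ i ∈ s, (b i : ℝ))
      = (2 * k + 1 : ℝ) * (∑ i ∈ s, (b i : ℝ)) - D * ∑ i ∈ s, (b i : ℝ) := by ring
  rw [this]
  linarith

/-- Pintz's Lemma 4′ in division form: for `k ≥ 1`,
`#{i ∈ s : b i > 0} ≥ (2k + 1 − D)/(k(k + 1)) · ∑ b`. [cite: Pintz2006, Lemma 4′] -/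
theorem lemma4'_div {ι : Type*} (s : Finset ι) (b : ι → ℕ) (D : ℝ) (k : ℕ) (hk : 1 ≤ k)
    (hD : (∑ i ∈ s, (b i : ℝ) ^ 2) ≤ D * ∑ i ∈ s, (b i : ℝ)) :
    ((2 * k + 1 : ℝ) - D) / (k * (k + 1)) * (∑ i ∈ s, (b i : ℝ))
      ≤ ((s.filter (fun i => 0 < b i)).card : ℝ) := by
  have hk' : (0 : ℝ) < k * (k + 1) := by
    have : (1 : ℝ) ≤ k := by exact_mod_cast hk
    positivity
  have h := lemma4'_general s b D k hD
  rw [div_mul_eq_mul_div, div_le_iff₀ hk']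
  linarith

/-- **Pintz's Lemma 4′ as printed.** If `b : ι → ℕ` on a finite set `s` satisfies `∑ b² ≤ D · ∑ b` with
`D ≥ 1`, then `#{i ∈ s : b i > 0} ≥ (⌈D⌉ + ⌊D⌋ − D)/(⌈D⌉ ⌊D⌋) · ∑ b` (natural-number ceiling and floor
`⌈D⌉₊`, `⌊D⌋₊`). For `D ∈ ℤ` the coefficient is `1/D` (Cauchy–Schwarz); for `D ∉ ℤ` it is
`(2⌊D⌋ + 1 − D)/(⌊D⌋(⌊D⌋ + 1)) > 1/D`. [cite: Pintz2006, Lemma 4′] -/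
theorem lemma4' {ι : Type*} (s : Finset ι) (b : ι → ℕ) {D : ℝ} (hD1 : 1 ≤ D)
    (hD : (∑ i ∈ s, (b i : ℝ) ^ 2) ≤ D * ∑ i ∈ s, (b i : ℝ)) :
    ((⌈D⌉₊ : ℝ) + ⌊D⌋₊ - D) / ((⌈D⌉₊ : ℝ) * ⌊D⌋₊) * (∑ i ∈ s, (b i : ℝ))
      ≤ ((s.filter (fun i => 0 < b i)).card : ℝ) := by
  have hD0 : (0 : ℝ) ≤ D := by linarith
  set k : ℕ := ⌊D⌋₊ with hk
  have hk1 : 1 ≤ k := Nat.le_floor (by exact_mod_cast hD1)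
  have hkpos : (0 : ℝ) < k := by exact_mod_cast hk1
  have hkle : (k : ℝ) ≤ D := Nat.floor_le hD0
  have hdiv := lemma4'_div s b D k hk1 hD
  by_cases hint : (k : ℝ) = D
  · -- `D = k` is an integer: `⌈D⌉₊ = k` and both coefficients equal `1/k`
    have hceil : ⌈D⌉₊ = k := by rw [← hint, Nat.ceil_natCast]
    have hc : (⌈D⌉₊ : ℝ) = k := by exact_mod_cast hceil
    rw [hc]
    have hcoef : ((k : ℝ) + k - D) / ((k : ℝ) * k) = ((2 * k + 1 : ℝ) - D) / (k * (k + 1)) := by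
      rw [← hint]
      field_simp
      ring
    rw [hcoef]
    exact hdiv
  · -- `D ∉ ℤ`: `⌈D⌉₊ = k + 1` and the coefficients agree literally
    have hlt : (k : ℝ) < D := lt_of_le_of_ne hkle hint
    have hceil : ⌈D⌉₊ = k + 1 := by
      have h1 : ⌈D⌉₊ ≤ k + 1 := Nat.ceil_le_floor_add_one D
      have h2 : k < ⌈D⌉₊ := by
        have : (k : ℝ) < ⌈D⌉₊ := lt_of_lt_of_le hlt (Nat.le_ceil D)
        exact_mod_cast this
      omega
    have hc : (⌈D⌉₊ : ℝ) = k + 1 := by exact_mod_cast hceil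
    rw [hc]
    have hcoef : ((k : ℝ) + 1 + k - D) / (((k : ℝ) + 1) * k) = ((2 * k + 1 : ℝ) - D) / (k * (k + 1)) := by
      congr 1 <;> ring
    rw [hcoef]
    exact hdiv

end Literature.NumberTheory.Sieve.Pintz2006
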